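import Summits.BirchSwinnertonDyer.BirchSwinnertonDyer.Theorems.ManinLocalTwoThreeDescentTwo
import Summits.BirchSwinnertonDyer.BirchSwinnertonDyer.Theorems.ManinLocalTwoThreeCThreeResidualOfFacts
import HarnessLib

/-!
# The `C₃`-image residual of crux C2 modulo the four typed facts only: E-es-37 (`j ≥ 2`) discharged

Summit `BirchSwinnertonDyer`, route `ManinLocalTwoThree` (cell bsd-f2-manin), crux C2 `ManinOddAtFour` (stmt-BirchSwinnertonDyer-22967),
line `kato_shift_two` v6, stub 3 `stub_cThreeImageResidual`.  p3's assembly `cThreeImageResidual_of_descent₂_and_facts` (p608031)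
takes five inputs: `h37` (the index-`2` descent E-es-37 for `j ≥ 2`), `h27` (F-es-27′: `H²(SL₂(𝔽_t); 𝔽₂) = 0` packaged as
EXT-CRIT), `h43` (E-es-43: the Serre amalgam / Mayer–Vietoris character extension on `Δ_t(L′)`), and the two Chebotarev leaves
`hNT2`, `hNT`.  The first is now a theorem (`shiftInvariantDescentTwo_two_of_two_le`, p608494); this file plugs it in:
**`cThreeImageResidual_of_facts h27 h43 hNT2 hNT : <stub_cThreeImageResidual signature verbatim>`** — stub 3 of the line is
thereby CONDITIONAL on exactly the four typed Literature/conjecture inputs and nothing else.  No new definitions; nothing about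
BSD or Manin's conjecture is proved here.

References: cell INBOX 2026-08-28T05:51:13Z (p3), 06:00Z (p2); HOME/MEMO-es.md §25.
-/

set_option autoImplicit false
set_option linter.dupNamespace false

open scoped MatrixGroups ModularForm

open CongruenceSubgroup Matrix.SpecialLinearGroup Literature.NumberTheory.EllipticCurves
  Literature.NumberTheory.EllipticCurves.ModularForms Literature.NumberTheory.EllipticCurves.ModularForms.HidaCohomology
  Summit.BirchSwinnertonDyer.Rank1Residual.ManinAdditive Literature.GroupTheory.SpecificGroups

namespace Summit.BirchSwinnertonDyer.BirchSwinnertonDyer.Theorems.ManinLocalTwoThree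

/-- **The `C₃`-image residual (crux C2 stub 3) modulo the four typed facts** F-es-27′, E-es-43, E-es-40₂, E-es-40:
p3's `cThreeImageResidual_of_descent₂_and_facts` with its descent hypothesis `h37` discharged by
`shiftInvariantDescentTwo_two_of_two_le`. [cite: Shimura1971, §8.3 (8.3.2)] -/
theorem cThreeImageResidual_of_facts
    (h27 : sl2ZModOddPrime_existsUnique_extension_of_stable_character)
    (h43 : gamma0Away_character_extension_of_shiftInvariant)
    (hNT2 : NotTrivialEisensteinOfIrreducibleAtTwo) (hNT : NotTrivialEisensteinOfIrreducibleTwo) :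
    ∀ (W : WeierstrassCurve ℚ) [W.IsElliptic] {N : ℕ} [NeZero N] (f : CuspForm (Gamma0 N) 2),
      IsNewformOf W f → 2 ^ 2 ∣ N → W.HasIrreducibleModPGaloisRep 2 →
      IsEisensteinEigensystem 2
        (fun ℓ : ℕ => algebraMap (ZMod 2) (AlgebraicClosure (ZMod 2)) ((W.LFunction ℓ : ℤ) : ZMod 2)) →
      ∀ φ : ↥(periodLattice f) →+ ZMod 2,
        (∀ x : ↥(periodLattice f), (x : ℂ) ∈
            periodLattice (∑ T ∈ (insert 8 (N.primeFactors.filter fun q => ¬ q ^ 2 ∣ N)).powerset,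
              (-1 : ℂ) ^ T.card • degeneracyMap0 N (8 * N ^ 2) (∏ t ∈ T, t - 1 + 1) 2 f) → φ x = 0) →
        φ = 0 :=
  cThreeImageResidual_of_descent₂_and_facts shiftInvariantDescentTwo_two_of_two_le h27 h43 hNT2 hNT

end Summit.BirchSwinnertonDyer.BirchSwinnertonDyer.Theorems.ManinLocalTwoThree
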